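import Literature.NumberTheory.DiophantineGeometry.FunctionFieldOnePointData
import Literature.NumberTheory.DiophantineGeometry.FunctionFieldConstantExtension
import HarnessLib

/-!
# The Stepanov–Bombieri upper bound, twisted by an automorphism (Stichtenoth Prop. 5.2.6)

Sibling **proof file** (theorems only; no definitions, no named facts, D-0014/D-0026) of
`FunctionFieldZeta`, second step toward the discharge of its named fact `hasseWeil`
(**Stichtenoth Thm. 5.2.1**, the Hasse–Weil theorem, in Bombieri's proof). Source:
H. Stichtenoth, *Algebraic Function Fields and Codes*, 2nd ed. (GTM 254), §5.2, Prop. 5.2.6,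
pp. 199–201 (held copy `book:stichtenothnd-algebraic-function-fields-codes`, text pp. 169–171), and
E. Bombieri, *Counting points on curves over finite fields (d'après S. A. Stepanov)*, Sém. Bourbaki
exp. 430 (1973).

* `card_le_of_forall_comapRingEquiv_eq`, `natCard_isRational_comapRingEquiv_eq_le` —
  **Prop. 5.2.6 in twisted form**: let `F/K` be a function field whose full constant field is the
  finite field `K`, of genus `g`; let `q₀ = p^e` be a power of the characteristic, `q = q₀²`, and
  let `θ` be a field automorphism of `F` with `θ(c) = c^q` on `K`. If `q > (g+1)⁴` then `F/K` has
  at most `q + (2g+1) q₀` rational places `P` with `θ(P) = P`.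

  For `K = 𝔽_q` and `θ = id` this is Prop. 5.2.6 exactly as printed
  (`N < q + 1 + (2g+1) q^{1/2}`). The twist is Bombieri's original formulation (points `x` with
  `φ(x) = γ(x)` for a Frobenius `φ` and an automorphism `γ`); it is what makes the Galois-theoretic
  lower bound (Stichtenoth Prop. 5.2.8, there phrased with the fixed fields `E_i` of the cyclic
  groups `⟨στ⟩`) available without developing fixed fields of function fields: the rational places
  of `E_i = E'^{⟨στ⟩}` are the `στ`-invariant rational places of `E'`.

  Proof as printed, verbatim up to the twist (see the docstring of
  `card_le_of_forall_comapRingEquiv_eq`): pole numbers and the basis `u_i` of `𝓛(mP₀)`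
  (through the tree's `onePointData`, `FunctionFieldOnePointData`: `poleNumbersLE`, `fn`,
  `finrank_L_add_card_gaps_filter`, `genus_onePointData` = Riemann–Roch Thm. 1.5.17 and the
  Weierstrass gap theorem 1.6.8), Claim 1 (distinct pole orders, `linearIndependent_of_deg_injective`),
  Claim 2 (a cardinality count replaces the dimension count, the map `λ` being only additive, exactly
  as the book remarks), Claim 3 with `z(P)^q` replaced by `(θz)(P)` (`value_ringEquiv_of_comapRingEquiv_eq`),
  and "zeros ≤ poles" (`card_le_of_value_eq_zero`, Thm. 1.4.11).
* Transport of places along field automorphisms (Lemma 3.5.2): `PlaceOver.ord_comapRingEquiv`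
  (`v_{θ⁻¹P}(x) = v_P(θx)`), invariance of `regularOutside`, `poleOrder`, and of values at
  `θ`-invariant rational places.

## References

* H. Stichtenoth, *Algebraic Function Fields and Codes*, 2nd ed., GTM 254, Springer 2009, §5.2
  Prop. 5.2.6; Lemma 3.5.2; Thm. 1.4.11, Thm. 1.5.17, Thm. 1.6.8. [Stichtenoth2009]
* E. Bombieri, *Counting points on curves over finite fields (d'après S. A. Stepanov)*,
  Sém. Bourbaki 430 (1973), Thm. 1 and its twisted form.
* A. Weil, *Sur les courbes algébriques et les variétés qui s'en déduisent*, Hermann 1948. [Weil1948]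
-/

noncomputable section

open scoped Classical

namespace Literature.NumberTheory.DiophantineGeometry.AlgFunctionField

universe u v

variable {K : Type u} {F : Type v} [Field K] [Field F] [Algebra K F]

namespace PlaceOver

section Transport

variable [Finite K] [IsAlgFunctionField K F]

/-- `θ` maps a uniformizer of `θ⁻¹(P)` to a uniformizer of `P`: `v_P(θ π_{θ⁻¹P}) = 1` (through the
multiplicative isomorphism `θ⁻¹(𝒪_P) ≃ 𝒪_P`, which preserves irreducibility). [folklore] -/
theorem ord_ringEquiv_uniformizer_comapRingEquiv (θ : F ≃+* F) (P : PlaceOver K F) :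
    P.ord (θ ((P.comapRingEquiv θ).uniformizer : F)) = 1 := by
  let eqv : (P.comapRingEquiv θ).toValuationSubring ≃* P.toValuationSubring :=
    { toFun := fun y => ⟨θ (y : F), y.2⟩
      invFun := fun y => ⟨θ.symm (y : F), by
        change θ (θ.symm (y : F)) ∈ P.toValuationSubring
        rw [RingEquiv.apply_symm_apply]; exact y.2⟩
      left_inv := fun y => Subtype.ext (θ.symm_apply_apply (y : F))
      right_inv := fun y => Subtype.ext (θ.apply_symm_apply (y : F))
      map_mul' := fun y z => Subtype.ext (map_mul θ (y : F) z) }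
  have hirr : Irreducible (eqv (P.comapRingEquiv θ).uniformizer) :=
    (MulEquiv.irreducible_iff eqv).2 (P.comapRingEquiv θ).irreducible_uniformizer
  have hmem : θ ((P.comapRingEquiv θ).uniformizer : F) ∈ P.toValuationSubring :=
    ((P.comapRingEquiv θ).uniformizer).2
  rw [P.ord_of_mem hmem]
  have : (⟨θ ((P.comapRingEquiv θ).uniformizer : F), hmem⟩ : P.toValuationSubring) =
      eqv (P.comapRingEquiv θ).uniformizer := rfl
  rw [this, IsDiscreteValuationRing.addVal_uniformizer hirr]
  rfl

/-- **The order of `θ x` at `P` is the order of `x` at `θ⁻¹(P)`** (automorphisms transport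
valuations; Stichtenoth Lemma 3.5.2). [cite: Stichtenoth2009, Lemma 3.5.2] -/
theorem ord_comapRingEquiv (θ : F ≃+* F) (P : PlaceOver K F) (x : F) :
    (P.comapRingEquiv θ).ord x = P.ord (θ x) := by
  rcases eq_or_ne x 0 with rfl | hx
  · rw [map_zero, PlaceOver.ord_zero, PlaceOver.ord_zero]
  set P' := P.comapRingEquiv θ with hP'
  set m : ℤ := P'.ord x with hm
  set π' : F := (P'.uniformizer : F) with hπ'
  have hπ'0 : π' ≠ 0 := P'.coe_uniformizer_ne_zero
  have hθx0 : θ x ≠ 0 := (map_ne_zero θ).2 hx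
  have hθπ0 : θ π' ≠ 0 := (map_ne_zero θ).2 hπ'0
  -- `u := x π'^{-m}` is a unit at `P'`, so `θ u` is a unit at `P`
  set u : F := x * π' ^ (-m) with hu
  have hu0 : u ≠ 0 := mul_ne_zero hx (zpow_ne_zero _ hπ'0)
  have hπ'1 : P'.ord π' = 1 := by simpa using P'.ord_uniformizer_zpow 1
  have hordu : P'.ord u = 0 := by
    rw [hu, P'.ord_mul_eq hx (zpow_ne_zero _ hπ'0), P'.ord_zpow hπ'0, hπ'1, ← hm]
    ring
  have huO : u ∈ P'.toValuationSubring := (P'.mem_toValuationSubring_iff_ord_nonneg hu0).2 hordu.ge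
  have huiO : u⁻¹ ∈ P'.toValuationSubring :=
    (P'.mem_toValuationSubring_iff_ord_nonneg (inv_ne_zero hu0)).2 (by rw [P'.ord_inv hu0]; omega)
  have hθu : θ u ∈ P.toValuationSubring := huO
  have hθui : (θ u)⁻¹ ∈ P.toValuationSubring := by rw [← map_inv₀]; exact huiO
  have hθu0 : θ u ≠ 0 := (map_ne_zero θ).2 hu0
  have hordθu : P.ord (θ u) = 0 := by
    have h1 := P.ord_nonneg_of_mem hθu
    have h2 := P.ord_nonneg_of_mem hθui
    rw [P.ord_inv hθu0] at h2
    omega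
  -- `x = u π'^m`, so `θ x = θ u · (θ π')^m`
  have hx' : θ x = θ u * θ π' ^ m := by
    rw [hu, map_mul, map_zpow₀, mul_assoc, ← zpow_add₀ hθπ0, neg_add_cancel, zpow_zero, mul_one]
  rw [hx', P.ord_mul_eq hθu0 (zpow_ne_zero _ hθπ0), hordθu, P.ord_zpow hθπ0,
    ord_ringEquiv_uniformizer_comapRingEquiv, zero_add, mul_one]

/-- At a `θ`-fixed place, `v_P(θ x) = v_P(x)`. [cite: Stichtenoth2009, Lemma 3.5.2] -/
theorem ord_ringEquiv_of_comapRingEquiv_eq {θ : F ≃+* F} {P : PlaceOver K F}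
    (h : P.comapRingEquiv θ = P) (x : F) : P.ord (θ x) = P.ord x := by
  rw [← ord_comapRingEquiv, h]

/-- `θ` maps `θ⁻¹(𝒪_v)`-membership to `𝒪_v`-membership: `θ x ∈ 𝒪_v ↔ x ∈ 𝒪_{θ⁻¹ v}`. [folklore] -/
theorem ringEquiv_mem_iff (θ : F ≃+* F) (v : PlaceOver K F) (x : F) :
    θ x ∈ v.toValuationSubring ↔ x ∈ (v.comapRingEquiv θ).toValuationSubring :=
  Iff.rfl

/-- `θ` maps the ball `t𝒪_P` of a `θ`-fixed place into itself. [folklore] -/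
theorem ringEquiv_mem_ball_one_of_comapRingEquiv_eq {θ : F ≃+* F} {P : PlaceOver K F}
    (h : P.comapRingEquiv θ = P) {x : F} (hx : x ∈ P.ball 1) : θ x ∈ P.ball 1 := by
  rw [P.mem_ball_iff, zpow_one, ← valuation_lt_one_iff_le] at hx ⊢
  have := (P.valuation_comapRingEquiv_lt_one_iff θ x)
  rw [h] at this
  exact this.1 hx

/-- Functions regular outside a `θ`-fixed place `Q` stay regular outside `Q` under `θ`.
[folklore] -/
theorem ringEquiv_mem_regularOutside {θ : F ≃+* F} {Q : PlaceOver K F}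
    (h : Q.comapRingEquiv θ = Q) {x : F} (hx : x ∈ Q.regularOutside) :
    θ x ∈ Q.regularOutside := by
  intro v hv
  rw [ringEquiv_mem_iff]
  refine hx _ fun heq => hv ?_
  rw [← h] at heq
  exact comapRingEquiv_injective θ heq

/-- The pole order at a `θ`-fixed place is `θ`-invariant. [folklore] -/
theorem poleOrder_ringEquiv_of_comapRingEquiv_eq {θ : F ≃+* F} {Q : PlaceOver K F}
    (h : Q.comapRingEquiv θ = Q) (x : F) : Q.poleOrder (θ x) = Q.poleOrder x := by
  rcases eq_or_ne x 0 with rfl | hx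
  · rw [map_zero]
  · rw [Q.poleOrder_of_ne_zero hx, Q.poleOrder_of_ne_zero ((map_ne_zero θ).2 hx),
      ord_ringEquiv_of_comapRingEquiv_eq h]

/-- **Values at a `θ`-fixed rational place**: if `θ` acts on the constants as `c ↦ φ c` then
`(θ y)(P) = φ (y(P))` for `y ∈ 𝒪_P`. [cite: Stichtenoth2009, Def. 1.1.15] -/
theorem value_ringEquiv_of_comapRingEquiv_eq {θ : F ≃+* F} {φ : K → K}
    (hθ : ∀ c : K, θ (algebraMap K F c) = algebraMap K F (φ c)) {P : PlaceOver K F}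
    (hP : P.IsRational) (h : P.comapRingEquiv θ = P) {y : F} (hy : y ∈ P.toValuationSubring) :
    P.value (θ y) = φ (P.value y) := by
  apply P.value_eq_of_sub_algebraMap_mem
  have h1 := ringEquiv_mem_ball_one_of_comapRingEquiv_eq h (hP.sub_value_mem hy)
  rwa [map_sub, hθ] at h1

end Transport

end PlaceOver

/-! ### Stepanov–Bombieri: the twisted upper bound (Stichtenoth Prop. 5.2.6, Bombieri 1973) -/

section Stepanov

open Literature.InformationTheory.Coding Finset

/-- `deg (f ^ k) = k • deg f` for one-point data. [folklore] -/
theorem OnePointData.deg_pow' {R : Type*} [CommRing R] [Algebra K R] {ι : Type*}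
    (S : OnePointData K R ι) (f : R) (k : ℕ) : S.deg (f ^ k) = k • S.deg f := by
  induction k with
  | zero => rw [pow_zero, zero_smul]; exact S.deg_one
  | succ k ih => rw [pow_succ, S.deg_mul', ih, succ_nsmul]

variable [Fintype K] [IsAlgFunctionField K F] [IsIntegrallyClosedIn K F]

/-- **Stepanov–Bombieri, twisted form of Stichtenoth Prop. 5.2.6** (core statement). Let `F/K` be
a function field with full constant field the finite field `K`, of genus `g`, let `q₀ = p^e` be a
power of the characteristic and `q = q₀²`, and let `θ` be a field automorphism of `F` acting on the
constants as `c ↦ c^q`. Suppose `q > (g + 1)⁴` and let `P₀` be a `θ`-invariant rational place. Then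
any family of distinct `θ`-invariant rational places other than `P₀` has at most
`r = q - 1 + (2g + 1) q₀ = (q₀ - 1) + (2g + q₀) q₀` members. (For `θ = id` and `K = 𝔽_q` this is
Prop. 5.2.6 as printed: `N < q + 1 + (2g+1) q^{1/2}`; the twist by `θ` is Bombieri's device for the
lower bound and replaces the fixed fields `E_i` of Prop. 5.2.8.) Proof as printed (pp. 199–201):
with `m = q₀ - 1`, `n = 2g + q₀`, the pole numbers `T` of `P₀` in `[0, m]` and `u_i` of pole order
`i ∈ T`, the additive maps `z ↦ ∑ u_i z_i^{q₀}` (injective: Claim 1, the pole orders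
`i + q₀ v(z_i)` are distinct) and `λ : z ↦ ∑ u_i^{q₀} θ(z_i)` from `𝓛(nP₀)^T` to
`𝓛((q₀m + n)P₀)`; `|𝓛(nP₀)^T| > |𝓛((q₀m+n)P₀)|` by Riemann–Roch and `q > (g+1)⁴` (Claim 2), so
some `z ≠ 0` has `λ(z) = 0`, and then `x = ∑ u_i z_i^{q₀} ≠ 0` lies in `𝓛(rP₀)` and vanishes at
every `θ`-invariant rational `P ≠ P₀`, because `x(P)^{q₀} = ∑ u_i(P)^{q₀} z_i(P)^{q} =
∑ u_i(P)^{q₀} (θ z_i)(P) = λ(z)(P) = 0` (Claim 3, using `(θ z)(P) = z(P)^q` at a `θ`-invariant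
rational place); finally a nonzero element of `𝓛(rP₀)` has at most `r` zeros.
[cite: Stichtenoth2009, Prop. 5.2.6] -/
theorem card_le_of_forall_comapRingEquiv_eq (p : ℕ) [ExpChar K p] (e : ℕ) (θ : F ≃+* F)
    (hθ : ∀ c : K, θ (algebraMap K F c) = algebraMap K F (c ^ (p ^ e) ^ 2))
    (hq : (genus K F + 1) ^ 4 < (p ^ e) ^ 2)
    {P₀ : PlaceOver K F} (hP₀ : P₀.IsRational) (hfix₀ : P₀.comapRingEquiv θ = P₀)
    {ι : Type*} [Fintype ι] {P : ι → PlaceOver K F} (hPinj : Function.Injective P)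
    (hPr : ∀ i, (P i).IsRational) (hPfix : ∀ i, (P i).comapRingEquiv θ = P i)
    (hP0 : ∀ i, P i ≠ P₀) :
    Fintype.card ι ≤ (p ^ e - 1) + (2 * genus K F + p ^ e) * p ^ e := by
  haveI : ExpChar F p := expChar_of_injective_algebraMap (algebraMap K F).injective p
  -- numerology
  set q₀ : ℕ := p ^ e with hq₀
  set g : ℕ := genus K F with hg
  have hq₀g : (g + 1) ^ 2 < q₀ := by
    have h : ((g + 1) ^ 2) ^ 2 < q₀ ^ 2 := by rw [← pow_mul]; exact hq
    exact lt_of_pow_lt_pow_left₀ 2 (Nat.zero_le _) h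
  have hq₀1 : 1 ≤ q₀ := by nlinarith
  have hgq₀ : g < q₀ := by nlinarith
  set m : ℕ := q₀ - 1 with hm
  set n : ℕ := 2 * g + q₀ with hn
  set N : ℕ := q₀ * m + n with hN
  -- the one-point data of `(F, P₀)` (no evaluation places needed)
  set S : OnePointData K P₀.regularOutside PEmpty.{1} :=
    onePointData P₀ (fun i : PEmpty.{1} => (i.elim : PlaceOver K F)) hP₀ (fun i => i.elim)
      (fun i => i.elim) (fun i => i.elim) with hS
  have hSdeg : ∀ x : P₀.regularOutside, S.deg x = P₀.poleOrder (x : F) := fun x => rfl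
  have hSg : S.genus = g := genus_onePointData hP₀ _ _ _
  -- dimensions (Riemann–Roch through the one-point data)
  set T := S.poleNumbersLE m with hT
  have hTcard : q₀ - g ≤ T.card := by
    have h1 := S.finrank_L_add_card_gaps_filter m
    rw [S.finrank_L, ← hT] at h1
    have h2 : (S.gaps.filter (· ≤ m)).card ≤ g := by
      rw [← hSg]; exact Finset.card_filter_le _ _
    omega
  have hLn : Module.finrank K (S.L n) = n + 1 - g := by
    have := S.finrank_L_add_genus (a := n) (by rw [hSg]; omega)
    rw [hSg] at this; omega
  have hLN : Module.finrank K (S.L N) = N + 1 - g := by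
    have := S.finrank_L_add_genus (a := N) (by rw [hSg, hN, hn]; omega)
    rw [hSg] at this; omega
  -- `θ` on `𝓛(∞P₀)` (additive)
  let θR : P₀.regularOutside →+ P₀.regularOutside :=
    { toFun := fun x => ⟨θ (x : F), PlaceOver.ringEquiv_mem_regularOutside hfix₀ x.2⟩
      map_zero' := Subtype.ext (map_zero θ)
      map_add' := fun x y => Subtype.ext (map_add θ (x : F) y) }
  have hθR : ∀ x : P₀.regularOutside, ((θR x : P₀.regularOutside) : F) = θ (x : F) := fun x => rfl
  have hdegθR : ∀ x : P₀.regularOutside, S.deg (θR x) = S.deg x := fun x => by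
    rw [hSdeg, hSdeg, hθR]
    exact PlaceOver.poleOrder_ringEquiv_of_comapRingEquiv_eq hfix₀ x
  -- the map `λ`
  have hmemB : ∀ z : T → S.L n, ∑ i : T, S.fn (i : ℕ) ^ q₀ * θR (z i : P₀.regularOutside) ∈ S.L N := by
    intro z
    refine Submodule.sum_mem _ fun i _ => ?_
    have hi : S.IsPoleNumber (i : ℕ) ∧ (i : ℕ) ≤ m := S.mem_poleNumbersLE.1 i.2
    rw [OnePointData.mem_L, S.deg_mul', OnePointData.deg_pow', S.deg_fn hi.1, hdegθR]
    have hz : S.deg ((z i : S.L n) : P₀.regularOutside) ≤ (n : ℕ) := (z i).2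
    calc q₀ • ((i : ℕ) : WithBot ℕ) + S.deg ((z i : S.L n) : P₀.regularOutside)
        ≤ q₀ • ((m : ℕ) : WithBot ℕ) + (n : ℕ) := by
          gcongr
          · exact_mod_cast hi.2
      _ = ((q₀ * m + n : ℕ) : WithBot ℕ) := by
          rw [nsmul_eq_mul]; norm_cast
  let B : (T → S.L n) →+ S.L N :=
    { toFun := fun z => ⟨∑ i : T, S.fn (i : ℕ) ^ q₀ * θR (z i : P₀.regularOutside), hmemB z⟩
      map_zero' := by
        apply Subtype.ext
        simp only [Pi.zero_apply, ZeroMemClass.coe_zero, map_zero, mul_zero,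
          Finset.sum_const_zero]
      map_add' := fun z z' => by
        apply Subtype.ext
        simp only [Pi.add_apply, Submodule.coe_add, map_add, mul_add, Finset.sum_add_distrib] }
  -- cardinalities: `|𝓛(NP₀)| < |𝓛(nP₀)^T|`
  haveI : Module.Finite K (S.L n) := S.finiteDimensional_L n
  haveI : Module.Finite K (S.L N) := S.finiteDimensional_L N
  haveI : Finite (S.L n) := Module.finite_of_finite K
  haveI : Finite (S.L N) := Module.finite_of_finite K
  letI : Fintype (S.L n) := Fintype.ofFinite _
  letI : Fintype (S.L N) := Fintype.ofFinite _
  have hcardK : 1 < Fintype.card K := Fintype.one_lt_card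
  have hcard : Fintype.card (S.L N) < Fintype.card (T → S.L n) := by
    rw [Fintype.card_fun, Fintype.card_coe, Fintype.card_eq_nat_card, Fintype.card_eq_nat_card,
      Module.natCard_eq_pow_finrank (K := K) (V := S.L N),
      Module.natCard_eq_pow_finrank (K := K) (V := S.L n), hLn, hLN, ← pow_mul,
      Nat.card_eq_fintype_card]
    apply Nat.pow_lt_pow_right hcardK
    -- `N + 1 - g < (n + 1 - g) * |T|`
    have h1 : (n + 1 - g) * (q₀ - g) ≤ (n + 1 - g) * T.card := Nat.mul_le_mul_left _ hTcard
    refine lt_of_lt_of_le ?_ h1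
    zify [hgq₀.le, hq₀1, (show g ≤ n + 1 by omega), (show g ≤ N + 1 by omega)]
    zify at hq₀g
    have hm' : (m : ℤ) = q₀ - 1 := by rw [hm]; push_cast [Nat.cast_sub hq₀1]; ring
    rw [hN, hn]
    push_cast
    rw [hm']
    nlinarith
  -- a nonzero `z` in the kernel of `λ`
  obtain ⟨z₁, z₂, hne, hBeq⟩ := Fintype.exists_ne_map_eq_of_card_lt B hcard
  set z : T → S.L n := z₁ - z₂ with hz
  have hz0 : z ≠ 0 := sub_ne_zero.2 hne
  have hBz : B z = 0 := by rw [hz, map_sub, hBeq, sub_self]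
  -- the function `x = ∑ u_i z_i^{q₀}`
  set x : P₀.regularOutside := ∑ i : T, S.fn (i : ℕ) * ((z i : S.L n) : P₀.regularOutside) ^ q₀
    with hx
  -- Claim 1: `x ≠ 0` (the pole orders `i + q₀ v(z_i)`, `i ∈ T`, are pairwise distinct)
  have hx0 : x ≠ 0 := by
    obtain ⟨i₀, hi₀⟩ : ∃ i, z i ≠ 0 := by
      by_contra h
      push Not at h
      exact hz0 (funext h)
    set s : Finset T := Finset.univ.filter fun i => z i ≠ 0 with hs
    have hi₀s : i₀ ∈ s := Finset.mem_filter.2 ⟨Finset.mem_univ _, hi₀⟩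
    let v : s → P₀.regularOutside := fun i =>
      S.fn ((i : T) : ℕ) * (((z i : S.L n) : P₀.regularOutside)) ^ q₀
    have hxv : x = ∑ i : s, v i := by
      have h1 : ∑ i : s, v i =
          ∑ i ∈ s, S.fn ((i : T) : ℕ) * (((z i : S.L n) : P₀.regularOutside)) ^ q₀ :=
        Finset.sum_coe_sort s fun i : T => S.fn ((i : T) : ℕ) * (((z i : S.L n) : P₀.regularOutside)) ^ q₀
      rw [h1, hs, Finset.sum_filter_of_ne, hx]
      intro i _ hi hzi
      apply hi
      rw [show ((z i : S.L n) : P₀.regularOutside) = 0 from by rw [hzi]; rfl,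
        zero_pow (pow_pos (expChar_pos K p) e).ne', mul_zero]
    have hq₀0 : q₀ ≠ 0 := (pow_pos (expChar_pos K p) e).ne'
    -- degrees of the `v i`
    have hzR0 : ∀ i : s, ((z i : S.L n) : P₀.regularOutside) ≠ 0 := fun i h =>
      (Finset.mem_filter.1 i.2).2 (Subtype.ext h)
    have hdegv : ∀ i : s, ∃ d : ℕ, S.deg ((z i : S.L n) : P₀.regularOutside) = d ∧
        S.deg (v i) = (((i : T) : ℕ) + q₀ * d : ℕ) := by
      intro i
      obtain ⟨d, hd⟩ := S.exists_deg_eq_coe (hzR0 i)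
      refine ⟨d, hd, ?_⟩
      have hi : S.IsPoleNumber ((i : T) : ℕ) := (S.mem_poleNumbersLE.1 (i : T).2).1
      change S.deg (S.fn ((i : T) : ℕ) * (((z i : S.L n) : P₀.regularOutside)) ^ q₀) = _
      rw [S.deg_mul', OnePointData.deg_pow', S.deg_fn hi, hd, nsmul_eq_mul]
      norm_cast
    have hv0 : ∀ i : s, v i ≠ 0 := by
      intro i h
      obtain ⟨d, -, hdv⟩ := hdegv i
      rw [h, S.deg_zero] at hdv
      exact WithBot.bot_ne_coe hdv
    have hinj : Function.Injective fun i : s => S.deg (v i) := by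
      intro i j hij
      obtain ⟨d, -, hdi⟩ := hdegv i
      obtain ⟨d', -, hdj⟩ := hdegv j
      simp only at hij
      rw [hdi, hdj] at hij
      have h' : ((i : T) : ℕ) + q₀ * d = ((j : T) : ℕ) + q₀ * d' := by exact_mod_cast hij
      have hi : ((i : T) : ℕ) ≤ m := (S.mem_poleNumbersLE.1 (i : T).2).2
      have hj : ((j : T) : ℕ) ≤ m := (S.mem_poleNumbersLE.1 (j : T).2).2
      have hmod := congr_arg (· % q₀) h'
      simp only [Nat.add_mul_mod_self_left, Nat.mod_eq_of_lt (show ((i : T) : ℕ) < q₀ by omega),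
        Nat.mod_eq_of_lt (show ((j : T) : ℕ) < q₀ by omega)] at hmod
      exact Subtype.ext (Subtype.ext hmod)
    have hli := S.linearIndependent_of_deg_injective v hv0 hinj
    intro hx0
    have h1 : ∑ i : s, (1 : K) • v i = 0 := by simp_rw [one_smul]; rw [← hxv]; exact hx0
    have := Fintype.linearIndependent_iff.1 hli (fun _ => (1 : K)) h1 ⟨i₀, hi₀s⟩
    exact one_ne_zero this
  -- `x ∈ 𝓛(rP₀)`, `r = m + n q₀`
  have hxdeg : P₀.poleOrder (x : F) ≤ ((m + n * q₀ : ℕ) : ℕ) := by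
    rw [← hSdeg]
    change x ∈ S.L (m + n * q₀)
    refine Submodule.sum_mem _ fun i _ => ?_
    have hi : S.IsPoleNumber ((i : T) : ℕ) ∧ ((i : T) : ℕ) ≤ m := S.mem_poleNumbersLE.1 i.2
    rw [OnePointData.mem_L, S.deg_mul', OnePointData.deg_pow', S.deg_fn hi.1]
    have hz : S.deg ((z i : S.L n) : P₀.regularOutside) ≤ (n : ℕ) := (z i).2
    calc (((i : T) : ℕ) : WithBot ℕ) + q₀ • S.deg ((z i : S.L n) : P₀.regularOutside)
        ≤ ((m : ℕ) : WithBot ℕ) + q₀ • ((n : ℕ) : WithBot ℕ) := by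
          gcongr
          · exact_mod_cast hi.2
      _ = ((m + n * q₀ : ℕ) : WithBot ℕ) := by
          rw [nsmul_eq_mul]; push_cast; ring
  -- Claim 3: `x` vanishes at every `θ`-invariant rational place `P i`
  have hval : ∀ i, (P i).value (x : F) = 0 := by
    intro i
    set ev := P₀.valueAlgHom (hPr i) (hP0 i) with hev
    have hevθ : ∀ y : P₀.regularOutside, ev (θR y) = ev y ^ (p ^ e) ^ 2 := fun y =>
      PlaceOver.value_ringEquiv_of_comapRingEquiv_eq (φ := fun c : K => c ^ (p ^ e) ^ 2) hθ
        (hPr i) (hPfix i) (y.2 _ (hP0 i))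
    have hq₀0 : q₀ ≠ 0 := (pow_pos (expChar_pos K p) e).ne'
    have key : ev x ^ q₀ = ev (B z : S.L N) := by
      change ev x ^ q₀ = ev (∑ j : T, S.fn (j : ℕ) ^ q₀ * θR (z j : P₀.regularOutside))
      rw [hx, map_sum, map_sum, hq₀, sum_pow_char_pow]
      refine Finset.sum_congr rfl fun j _ => ?_
      rw [map_mul, map_mul, map_pow, map_pow, hevθ, mul_pow, ← pow_mul, ← sq]
    rw [hBz] at key
    have : ev x = 0 := pow_eq_zero_iff hq₀0 |>.1 (by rw [key]; simp)
    simpa [hev] using this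
  have hx0' : (x : F) ≠ 0 := fun h => hx0 (Subtype.ext h)
  have := card_le_of_value_eq_zero hP₀ hPinj hPr hP0 x.2 hx0' hxdeg Finset.univ
    (fun i _ => hval i)
  rw [Finset.card_univ] at this
  calc Fintype.card ι ≤ m + n * q₀ := this
    _ = (p ^ e - 1) + (2 * genus K F + p ^ e) * p ^ e := by rw [hm, hn]

/-- **The twisted Stepanov–Bombieri bound, counting form** (Stichtenoth Prop. 5.2.6 for `θ = id`;
Bombieri 1973, Thm. 1 bis, for general `θ`): under the hypotheses of
`card_le_of_forall_comapRingEquiv_eq` (`q = q₀² > (g+1)⁴`, `θ` acting on the finite full constant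
field `K` as `c ↦ c^q`), the number of `θ`-invariant rational places of `F/K` is at most
`q + (2g + 1) q₀` (`< q + 1 + (2g+1) q^{1/2}` as printed). [cite: Stichtenoth2009, Prop. 5.2.6] -/
theorem natCard_isRational_comapRingEquiv_eq_le (p : ℕ) [ExpChar K p] (e : ℕ) (θ : F ≃+* F)
    (hθ : ∀ c : K, θ (algebraMap K F c) = algebraMap K F (c ^ (p ^ e) ^ 2))
    (hq : (genus K F + 1) ^ 4 < (p ^ e) ^ 2) :
    Nat.card {P : PlaceOver K F // P.IsRational ∧ P.comapRingEquiv θ = P} ≤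
      (p ^ e) ^ 2 + (2 * genus K F + 1) * p ^ e := by
  have hfin : {P : PlaceOver K F | P.IsRational ∧ P.comapRingEquiv θ = P}.Finite :=
    (finite_setOf_degree_eq (K := K) (F := F) 1).subset fun P hP => hP.1
  haveI : Finite {P : PlaceOver K F // P.IsRational ∧ P.comapRingEquiv θ = P} := hfin.to_subtype
  letI : Fintype {P : PlaceOver K F // P.IsRational ∧ P.comapRingEquiv θ = P} := Fintype.ofFinite _
  have hq₀1 : 1 ≤ p ^ e := pow_pos (expChar_pos K p) e
  have hr : (p ^ e - 1) + (2 * genus K F + p ^ e) * p ^ e + 1 =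
      (p ^ e) ^ 2 + (2 * genus K F + 1) * p ^ e := by
    zify [hq₀1]; ring
  rw [Nat.card_eq_fintype_card]
  rcases isEmpty_or_nonempty {P : PlaceOver K F // P.IsRational ∧ P.comapRingEquiv θ = P}
    with hemp | ⟨⟨P₀, hP₀, hfix₀⟩⟩
  · rw [Fintype.card_eq_zero]; exact Nat.zero_le _
  · set X₀ : {P : PlaceOver K F // P.IsRational ∧ P.comapRingEquiv θ = P} := ⟨P₀, hP₀, hfix₀⟩
      with hX₀
    have h := card_le_of_forall_comapRingEquiv_eq p e θ hθ hq hP₀ hfix₀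
      (ι := {Q : {P : PlaceOver K F // P.IsRational ∧ P.comapRingEquiv θ = P} // Q ≠ X₀})
      (P := fun Q => Q.1.1) (fun Q Q' hQQ' => Subtype.ext (Subtype.ext hQQ'))
      (fun Q => Q.1.2.1) (fun Q => Q.1.2.2)
      (fun Q hQ => Q.2 (Subtype.ext hQ))
    rw [Fintype.card_subtype, Finset.filter_ne', Finset.card_erase_of_mem (Finset.mem_univ _),
      Finset.card_univ] at h
    omega

end Stepanov

end Literature.NumberTheory.DiophantineGeometry.AlgFunctionField
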